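import Mathlib
import HarnessLib
import Summits.CriticalPhenomena.PercolationContinuityZ3.Theses.PercBoundarySqueeze
import Summits.CriticalPhenomena.PercolationContinuityZ3.Theses.PercLowPointHalfSpace
import Summits.CriticalPhenomena.PercolationContinuityZ3.Theses.PercFoamCut
import Summits.CriticalPhenomena.PercolationContinuityZ3.Theorems.QuantitativeBGN.Negative.ArmLowerBound

/-!
# Crux `PercBoundarySqueeze.HalfSpaceOneArmRate` (stmt-CriticalPhenomena-6983) — its place in the half-space arm ladder

Helper file landed `--supports stmt-CriticalPhenomena-6983` by the line lead (continuation c2, line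
`registered`). Three open cruxes of three routes are RATE statements for ONE event,
`armH r = {∃ y, ‖y‖∞ ≥ r ∧ 0 ↔ y open inside H}`, `H = {x | 0 ≤ x 0}`, under `P_{p_c(ℤ³)}`
(`Theorems/QuantitativeBGN/Negative/ArmLowerBound.lean`):

* `PercBoundarySqueeze.HalfSpaceOneArmRate` (stmt-6983): `∃ b > 1/2, C, ∀ r ≥ 1, P(armH r) ≤ C r^{-b}`;
* `PercLowPointHalfSpace.QuantitativeBGN` (stmt-0913; verbatim also in `PercLayerChain`, `PercPorousCritical`,
  `PercPortalLadder`, `PercFoamCut`): the same with `∃ a > 0`;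
* `PercFoamCut.LogBGN` (stmt-5334): `log r · P(armH r) → 0`.

This file records, sorry-free and over tree vocabulary only, the kernel-checked ORDER of the ladder:

* `halfSpaceOneArmRate_iff_exists_with` : `HalfSpaceOneArmRate ↔ ∃ b > 1/2, QuantitativeBGNWith b`;
* `halfSpaceOneArmRate_iff_window` : `… ↔ ∃ b, 1/2 < b ≤ 2 ∧ QuantitativeBGNWith b` (the disprover's floor
  `not_quantitativeBGNWith_of_two_lt` caps the exponent at `2 = d - 1`);
* `quantitativeBGN_of_halfSpaceOneArmRate` : stmt-6983 ⇒ stmt-0913 (so every dead line / census entry of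
  the 0913 programme is a constraint on 6983, and 6983 cannot close before 0913 can);
* `logBGN_of_quantitativeBGNWith`, `logBGN_of_quantitativeBGN`, `logBGN_of_halfSpaceOneArmRate` :
  any polynomial rate gives the logarithmic rate of stmt-5334.

No definitions, no sorry. Sources: Barsky–Grimmett–Newman (1991) (`θ_H(p_c) = 0`, rate-free; in tree as
`Literature.Probability.Percolation.BarskyGrimmettNewman1991_Z3_holds`); Grimmett, *Percolation* (1999) Thm. (7.35)
[GrimmettPercolation1999].
-/

noncomputable section

namespace Summit.CriticalPhenomena.PercolationContinuityZ3.Theorems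

namespace HalfSpaceOneArmRateDominates

open MeasureTheory Filter
open scoped Topology
open Literature.Probability.Percolation Literature.Probability.LatticeModels
open Summit.CriticalPhenomena.PercolationContinuityZ3.Theses.PercBoundarySqueeze (HalfSpaceOneArmRate)
open Summit.CriticalPhenomena.PercolationContinuityZ3.Theses.PercLowPointHalfSpace (QuantitativeBGN)
open Summit.CriticalPhenomena.PercolationContinuityZ3.Theses.PercFoamCut (LogBGN)
open Summit.CriticalPhenomena.PercolationContinuityZ3.Theorems.QuantitativeBGN.Negative
  (armH QuantitativeBGNWith quantitativeBGN_iff_exists_with not_quantitativeBGNWith_of_two_lt)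

/-! ## Readback: the crux with a named exponent -/

/-- READBACK: `HalfSpaceOneArmRate ↔ ∃ b > 1/2, QuantitativeBGNWith b` — the crux is the fixed-exponent
form of the 0913 Negative lane with the threshold `1/2`. [folklore] -/
theorem halfSpaceOneArmRate_iff_exists_with :
    HalfSpaceOneArmRate ↔ ∃ b : ℝ, 1 / 2 < b ∧ QuantitativeBGNWith b := by
  constructor
  · rintro ⟨b, C, hb, h⟩
    exact ⟨b, hb, C, h⟩
  · rintro ⟨b, hb, C, h⟩
    exact ⟨b, C, hb, h⟩

/-- **The admissible window of the crux is `1/2 < b ≤ 2`.** `HalfSpaceOneArmRate ↔ ∃ b, 1/2 < b ≤ 2 ∧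
QuantitativeBGNWith b`: an exponent `b > 2` contradicts the floor `P_{p_c}(armH (n+1)) ≥ 1/(588 (n+1)²)`
(`not_quantitativeBGNWith_of_two_lt`). [folklore] -/
theorem halfSpaceOneArmRate_iff_window :
    HalfSpaceOneArmRate ↔ ∃ b : ℝ, 1 / 2 < b ∧ b ≤ 2 ∧ QuantitativeBGNWith b := by
  rw [halfSpaceOneArmRate_iff_exists_with]
  constructor
  · rintro ⟨b, hb, h⟩
    refine ⟨b, hb, ?_, h⟩
    by_contra h2
    exact not_quantitativeBGNWith_of_two_lt (not_le.mp h2) h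
  · rintro ⟨b, hb, -, h⟩
    exact ⟨b, hb, h⟩

/-! ## The ladder `HalfSpaceOneArmRate ⇒ QuantitativeBGN ⇒ LogBGN` -/

/-- **stmt-6983 ⇒ stmt-0913.** The half-space one-arm rate with threshold `1/2` implies the sibling crux
`QuantitativeBGN` (`∃ a > 0`, same event): take `a = b`. [folklore] -/
theorem quantitativeBGN_of_halfSpaceOneArmRate (h : HalfSpaceOneArmRate) : QuantitativeBGN := by
  obtain ⟨b, C, hb, hC⟩ := h
  exact ⟨b, C, by linarith, hC⟩

/-- `log r · r^{-a} → 0` along the naturals, for `a > 0`. [folklore] -/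
theorem tendsto_log_mul_rpow_neg {a : ℝ} (ha : 0 < a) :
    Tendsto (fun r : ℕ => Real.log (r : ℝ) * (r : ℝ) ^ (-a)) atTop (𝓝 0) := by
  have h := ((isLittleO_log_rpow_atTop ha).tendsto_div_nhds_zero).comp tendsto_natCast_atTop_atTop
  refine h.congr' ?_
  filter_upwards [eventually_ge_atTop 1] with r hr
  have hr0 : (0 : ℝ) ≤ (r : ℝ) := by positivity
  simp only [Function.comp_apply, div_eq_mul_inv, Real.rpow_neg hr0]

/-- **Polynomial rate ⇒ logarithmic rate.** `QuantitativeBGNWith a` with `a > 0` implies `LogBGN`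
(stmt-5334): `0 ≤ log r · P(armH r) ≤ |C| · log r · r^{-a} → 0`. [folklore] -/
theorem logBGN_of_quantitativeBGNWith {a : ℝ} (ha : 0 < a) (h : QuantitativeBGNWith a) : LogBGN := by
  obtain ⟨C, hC⟩ := h
  -- `LogBGN` is literally the statement for the event `armH r`
  show Tendsto (fun r : ℕ => Real.log (r : ℝ) *
      (bondPercolation (zdGraph 3) (criticalProbI 3)).real (armH r)) atTop (𝓝 0)
  have hlim : Tendsto (fun r : ℕ => |C| * (Real.log (r : ℝ) * (r : ℝ) ^ (-a))) atTop (𝓝 0) := by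
    simpa using (tendsto_log_mul_rpow_neg ha).const_mul |C|
  refine tendsto_of_tendsto_of_tendsto_of_le_of_le' tendsto_const_nhds hlim ?_ ?_
  · filter_upwards [eventually_ge_atTop 1] with r hr
    have hlog : 0 ≤ Real.log (r : ℝ) := Real.log_nonneg (by exact_mod_cast hr)
    exact mul_nonneg hlog measureReal_nonneg
  · filter_upwards [eventually_ge_atTop 1] with r hr
    have hlog : 0 ≤ Real.log (r : ℝ) := Real.log_nonneg (by exact_mod_cast hr)
    have hr0 : (0 : ℝ) ≤ (r : ℝ) := by positivity
    have hpow : 0 ≤ (r : ℝ) ^ (-a) := Real.rpow_nonneg hr0 _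
    have h1 : (bondPercolation (zdGraph 3) (criticalProbI 3)).real (armH r) ≤ |C| * (r : ℝ) ^ (-a) :=
      (hC r hr).trans (mul_le_mul_of_nonneg_right (le_abs_self C) hpow)
    calc Real.log (r : ℝ) * (bondPercolation (zdGraph 3) (criticalProbI 3)).real (armH r)
        ≤ Real.log (r : ℝ) * (|C| * (r : ℝ) ^ (-a)) := mul_le_mul_of_nonneg_left h1 hlog
      _ = |C| * (Real.log (r : ℝ) * (r : ℝ) ^ (-a)) := by ring

/-- **stmt-0913 ⇒ stmt-5334.** [folklore] -/
theorem logBGN_of_quantitativeBGN (h : QuantitativeBGN) : LogBGN := by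
  obtain ⟨a, ha, hW⟩ := quantitativeBGN_iff_exists_with.mp h
  exact logBGN_of_quantitativeBGNWith ha hW

/-- **stmt-6983 ⇒ stmt-5334.** [folklore] -/
theorem logBGN_of_halfSpaceOneArmRate (h : HalfSpaceOneArmRate) : LogBGN :=
  logBGN_of_quantitativeBGN (quantitativeBGN_of_halfSpaceOneArmRate h)

end HalfSpaceOneArmRateDominates

end Summit.CriticalPhenomena.PercolationContinuityZ3.Theorems
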